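import Mathlib
import HarnessLib
import Summits.QuantumFields.YangMills.Theses.LangevinControlUV
import Summits.QuantumFields.YangMills.Theorems.FemtoCurvatureSkewness.Negative.ZeroCoupling
import Summits.QuantumFields.YangMills.Theorems.FemtoCurvatureSkewness.Negative.WildUnitMap
import Summits.QuantumFields.YangMills.Theorems.FemtoCurvatureSkewness.Negative.WildPackage

/-!
# `FemtoCurvatureSkewness` — NEGATIVE LEMMA: the typed crux is false modulo `UniformZeros`

Crux `stmt-QuantumFields-9365` (`LangevinControlUV.FemtoCurvatureSkewness`), lead of line `Sketch-ideator3`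
(prover-line-stmt-QuantumFields-9365-0, 2026-08-16).

`UniformZeros` (the hypothesis `H`, NOT constructible in the tree today): for some compact simple `G` and lattice
representation `r`, (i) above a coupling `βu` the torus Wilson covariances of the plaquette field are uniformly comparable
(POS, UNIF-L, UNIF-B, UNIF-B', UNIF-O of `Negative/WildPackage.lean` — physically standard weak-coupling/infrared
regularity, each containing 4-d Yang–Mills control the tree does not have), and (ii) the crux cumulant has EXACT zeros
`κ₃(L_k, β_k, n_k) = 0` along a sequence `β_k → ∞` in some volumes `L_k ≥ 8 n_k` (the open infrared-sign question of
Disproof.lean finding 3: the strong-coupling sign is `−` against the tree-level `+` for `(G, r)` with `r ⊗ r ∋ r` or `r̄`,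
e.g. `SU(3)` fundamental, so zeros `β*(L, n)` exist on every torus by `exists_zero_of_sign_change`; (ii) asks that they
persist as `β → ∞`).

`FemtoCurvatureSkewness_false_of_UniformZeros : UniformZeros → ¬ FemtoCurvatureSkewness`: by `twoPointPackage_wild` a
choice-constructed unit map below `e^{-β}/(1 + Σ_{β_k = β} L_k)` carries the two-point package, and every zero of (ii)
is then admissible for the skewness package the crux would hand back (`level_mem_window`) — contradiction.  So the TYPED
`∀ a` crux is equivalent, modulo (i), to global non-vanishing of `κ₃` above some `β₁` in all volumes; the planners'
∃-bundled repair (Memo R1) is untouched by this lemma.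
-/

noncomputable section

namespace Summit.QuantumFields.YangMills.Theorems.FemtoCurvatureSkewness.Negative

open MeasureTheory Filter Topology Function
open Literature.MathematicalPhysics.QuantumFieldTheory
open Summit.QuantumFields.YangMills.Theses.LangevinControlUV (FemtoCurvatureSkewness)

/-- **Hypothesis `UniformZeros`** (covariance uniformities above a coupling ∧ exact zeros of the crux cumulant along
`β_k → ∞`), for some compact simple `G` and lattice representation `r`; see the module docstring.  Not constructible in
the tree today. -/
def UniformZeros : Prop :=
  ∃ (G : Type) (_ : Group G) (_ : TopologicalSpace G) (_ : IsTopologicalGroup G)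
      (_ : CompactSpace G) (_ : IsCompactSimpleLieGroup G),
      letI : MeasurableSpace G := borel G
      haveI : BorelSpace G := ⟨rfl⟩
      ∃ (r : LatticeRep G) (βu K : ℝ), 1 ≤ K ∧
        (∀ (L : ℕ) [NeZero L] (β : ℝ) (n : ℕ), βu ≤ β → 1 ≤ n → 8 * n ≤ L →
          0 < wCov r L β (plaq r L 0 0 1) (plaq r L (Pi.single (2 : Fin 4) ((n : ℕ) : ZMod L)) 0 1)) ∧
        (∀ (L L' : ℕ) [NeZero L] [NeZero L'] (β : ℝ) (n : ℕ), βu ≤ β → 1 ≤ n → 8 * n ≤ L → 8 * n ≤ L' →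
          wCov r L β (plaq r L 0 0 1) (plaq r L (Pi.single (2 : Fin 4) ((n : ℕ) : ZMod L)) 0 1) ≤
            K * wCov r L' β (plaq r L' 0 0 1) (plaq r L' (Pi.single (2 : Fin 4) ((n : ℕ) : ZMod L')) 0 1)) ∧
        (∀ (L : ℕ) [NeZero L] (β : ℝ) (n : ℕ), βu ≤ β → 1 ≤ n → 8 * n ≤ L →
          (n : ℝ) ^ 8 * wCov r L β (plaq r L 0 0 1) (plaq r L (Pi.single (2 : Fin 4) ((n : ℕ) : ZMod L)) 0 1)
            ≤ K) ∧
        (∀ (L : ℕ) [NeZero L] (β : ℝ) (x y : Site 4 L) (i j i' j' : Fin 4), βu ≤ β → x ≠ y → i ≠ j →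
          i' ≠ j' → |wCov r L β (plaq r L x i j) (plaq r L y i' j')| * torusDist L x y ^ 8 ≤ K) ∧
        (∀ (L L' : ℕ) [NeZero L] [NeZero L'] (β : ℝ) (n : ℕ) (x y : Site 4 L) (i j i' j' : Fin 4),
          βu ≤ β → 1 ≤ n → 8 * n ≤ L' → x ≠ y → i ≠ j → i' ≠ j' → torusDist L x y = n →
          |wCov r L β (plaq r L x i j) (plaq r L y i' j')| ≤
            K * wCov r L' β (plaq r L' 0 0 1) (plaq r L' (Pi.single (2 : Fin 4) ((n : ℕ) : ZMod L')) 0 1)) ∧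
        ∃ (βz : ℕ → ℝ) (Lz nz : ℕ → ℕ), Tendsto βz atTop atTop ∧
          ∀ k, ∃ (_ : NeZero (Lz k)), 1 ≤ nz k ∧ 8 * nz k ≤ Lz k ∧ kappa3 r (Lz k) (βz k) (nz k) = 0

/-- **NEGATIVE LEMMA.** `UniformZeros → ¬ FemtoCurvatureSkewness`: under the covariance uniformities a wild unit map
below `e^{-β}/(1 + Σ_{β_k = β} L_k)` carries the two-point package (`twoPointPackage_wild`); the skewness package the crux
returns for it is contradicted at any zero `κ₃(L_k, β_k, n_k) = 0` with `β_k ≥ β₁` and `e^{-β_k} ≤ ℓ₁`. -/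
theorem FemtoCurvatureSkewness_false_of_UniformZeros : UniformZeros → ¬ FemtoCurvatureSkewness := by
  intro h hcrux
  unfold UniformZeros at h
  obtain ⟨G, _, _, _, _, hG, r, βu, K, hK, hPOS, hUL, hUB, hUB', hUO, βz, Lz, nz, hβz, hzero⟩ := h
  letI : MeasurableSpace G := borel G
  haveI : BorelSpace G := ⟨rfl⟩
  -- each coupling value is hit by finitely many `k`
  have hfin : ∀ β : ℝ, {k : ℕ | βz k = β}.Finite := by
    intro β
    obtain ⟨N, hN⟩ := (hβz.eventually (eventually_gt_atTop β)).exists_forall_of_atTop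
    refine (Set.finite_lt_nat N).subset fun k hk => ?_
    by_contra hkN
    have hk' : βz k = β := hk
    exact (hN k (not_lt.1 hkN)).ne' hk'
  -- a positive envelope `g → 0` with `L_k · g(β_k) ≤ e^{-β_k}`
  let F : ℝ → ℝ := fun β => ∑ k ∈ (hfin β).toFinset, (Lz k : ℝ)
  have hF0 : ∀ β, 0 ≤ F β := fun β => Finset.sum_nonneg fun k _ => Nat.cast_nonneg _
  have hFk : ∀ k, (Lz k : ℝ) ≤ F (βz k) := fun k =>
    Finset.single_le_sum (f := fun k => (Lz k : ℝ)) (fun _ _ => Nat.cast_nonneg _)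
      ((hfin (βz k)).mem_toFinset.2 rfl)
  let g : ℝ → ℝ := fun β => Real.exp (-β) / (1 + F β)
  have hg : ∀ β, 0 < g β := fun β => div_pos (Real.exp_pos _) (by linarith [hF0 β])
  have hg_le : ∀ β, g β ≤ Real.exp (-β) := fun β =>
    div_le_self (Real.exp_pos _).le (by linarith [hF0 β])
  have hg0 : Tendsto g atTop (𝓝 0) :=
    tendsto_of_tendsto_of_tendsto_of_le_of_le tendsto_const_nhds Real.tendsto_exp_neg_atTop_nhds_zero
      (fun β => (hg β).le) hg_le
  obtain ⟨a, hPkg, hag⟩ := twoPointPackage_wild r hK hPOS hUL hUB hUB' hUO g hg hg0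
  obtain ⟨Γ, β₀, ℓ₀, c, C, -, -, ha, -, -⟩ := id hPkg
  obtain ⟨Γ₃, β₁, ℓ₁, c₃, hℓ₁, hc₃, hΓ₃, hb⟩ := femtoCurvatureSkewness_iff.1 hcrux G hG r a hPkg
  -- a zero at large coupling, inside the window
  have hev : ∀ᶠ k in atTop, β₁ ≤ βz k ∧ Real.exp (-(βz k)) ≤ ℓ₁ := by
    have h1 : ∀ᶠ k in atTop, β₁ ≤ βz k := hβz.eventually (eventually_ge_atTop β₁)
    have h2 : ∀ᶠ k in atTop, Real.exp (-(βz k)) ≤ ℓ₁ :=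
      (Real.tendsto_exp_neg_atTop_nhds_zero.comp hβz).eventually (eventually_le_nhds hℓ₁)
    exact h1.and h2
  obtain ⟨k, hk1, hk2⟩ := hev.exists
  obtain ⟨hLz, hn1, hn8, hz⟩ := hzero k
  have hbox : (Lz k : ℝ) * a (βz k) ≤ ℓ₁ := by
    have h1 : a (βz k) ≤ g (βz k) := hag _
    have h3 : (Lz k : ℝ) ≤ 1 + F (βz k) := by linarith [hFk k]
    have h4 : (1 + F (βz k)) * g (βz k) = Real.exp (-(βz k)) := by
      have : (0 : ℝ) < 1 + F (βz k) := by linarith [hF0 (βz k)]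
      simp only [g]
      field_simp
    calc (Lz k : ℝ) * a (βz k) ≤ (Lz k : ℝ) * g (βz k) := mul_le_mul_of_nonneg_left h1 (Nat.cast_nonneg _)
      _ ≤ (1 + F (βz k)) * g (βz k) := mul_le_mul_of_nonneg_right h3 (hg _).le
      _ = Real.exp (-(βz k)) := h4
      _ ≤ ℓ₁ := hk2
  have key := hb (Lz k) (βz k) hk1 hbox (nz k) hn1 hn8
  rw [hz, abs_zero, mul_zero] at key
  obtain ⟨hs, hsℓ⟩ := level_mem_window ha hbox hn1 hn8
  exact absurd key (not_le.2 (mul_pos hc₃ (hΓ₃ _ hs hsℓ)))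


end Summit.QuantumFields.YangMills.Theorems.FemtoCurvatureSkewness.Negative

end
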